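import Literature.MathematicalPhysics.QuantumFieldTheory.Balaban1983to89.Beta.BalabanStepJetsSucc

/-!
# `BalabanUV.Beta.GAN24.FaceWordEECellOne` — binder row G-an2-4 ∕ (CONV-C), W-slot (α-0), ROW (C)sym AT LEVELS `≥ 1`, typer's PART VI row **T6-VAL**, letter **K7-b's first
# identity is definitional**: at `N = 1` the tent term of `FaceWordEEValueDeep.cellPairing_deep_value` VANISHES (the period-`1` profile `q^{(1)} ≡ 0`), so the face-gated word
# at fine period `Lc·1` — the zero mode's pushed form — has the value `(−½)(½)·sf²·wVH_{j+1}⁻¹·⟨q^{(Lc)}, E2_{j+1} q^{(Lc)}⟩` of the CELL word (J2 ∕ gen 53 `ExchangeESectorValue`) with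
# the SAME prefactor as every deeper face word: `CrossedLedgerTelescope`'s `hκ` holds with `γ = 1` in this currency (ENGINE E-leaf06-g56-1: κ_1 = λ exactly).
# (G-an2-4 CRUX TEAM (2), seat `b2b-balaban-gan24-formalise-leaf-06` = the (γ) hand, gen 56; journal [GAN24LEAF06-G56-INTENT6])

NOT IN PRINT; OUR BOOKKEEPING ([folklore] finite bookkeeping: `Int.emod_one`, `Nat.cast_one`; 0 `def`, 0 cited fact, 0 `def … : Prop`, 0 sorry).  HONEST FRAMING (cell contract,
verbatim): «discharging `BetaPertH` makes Bałaban's UV stability UNCONDITIONAL — a real constructive-QFT result; it is NOT the continuum limit and NOT the Clay problem.»  HONEST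
DEPENDENCY (verbatim): «continuum YM on T⁴ ⇐ BetaPertH ∧ nine spine estimates (0/9 proved); BetaPertH ⇐ (D1) ∧ (D4) ∧ CAP+tail; G-an2-4 gates asym, D1 and NE2/3/4.»
WHAT: `qProfileOne_eq_zero` (the period-`1` profile is `0`), **`deepPairing_one_eq_zero`** (the level-`(j+2)` pairing on `box 1` against period-`1` profiles is `0`).  Asserts NO value of
Bałaban's tables; discharges NOTHING of `hX` ∕ `hXu` ∕ (C)_{≥1} ∕ `hB0` ∕ `hBF`; NEVER «G-an2-4 closed» as (CONV-C); NOT D1, NOT `BetaPertH`, NOT continuum, NOT Clay.  2026-08-24.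
-/

noncomputable section

open Finset
open scoped BigOperators
open Literature.MathematicalPhysics.QuantumFieldTheory
open Literature.MathematicalPhysics.QuantumFieldTheory.Balaban1983to89
open Literature.MathematicalPhysics.QuantumFieldTheory.Balaban1983to89.Beta
open ExpKernelCalculus (Site)
open AffineAveraging (box toSite)
open BalabanStepJetsSucc (E2)

namespace Summit.QuantumFields.BalabanUV.Beta.GAN24.FaceWordEECellOne

variable {d : ℕ} {Lc : ℕ} [NeZero Lc]

omit [NeZero Lc] in
/-- [folklore] **THE PERIOD-`1` PROFILE VANISHES**: `q^{(1)}_{νβ}(b′, s) = 0` (`s % 1 = 0`, `(1 − 1)∕2 = 0`). -/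
theorem qProfileOne_eq_zero (ν β b' : Fin (d + 1)) (s : Site (d + 1)) :
    ((if b' = ν then ((((1 : ℕ) : ℝ))⁻¹ * (((1 : ℕ) : ℝ))⁻¹) * ((((s β % ((1 : ℕ) : ℤ)) : ℤ) : ℝ) - (((1 : ℕ) : ℝ) - 1) / 2) else 0)
      + (if b' = β then (-(((1 : ℕ) : ℝ))⁻¹ * ((((s ν % ((1 : ℕ) : ℤ)) : ℤ) : ℝ) - (((1 : ℕ) : ℝ) - 1) / 2)) *
          (if s β % ((1 : ℕ) : ℤ) = ((1 : ℕ) : ℤ) - 1 then (1 : ℝ) else 0) else 0)) = 0 := by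
  simp only [Nat.cast_one, Int.emod_one, Int.cast_zero, sub_self, zero_div, mul_zero, zero_mul, ite_self, add_zero]

/-- NOT IN PRINT; OUR BOOKKEEPING.  **AT `N = 1` THE TENT TERM OF `cellPairing_deep_value` IS ZERO**: the level-`(j+2)` pairing on `box 1` against the period-`1` profiles vanishes,
so the face-gated word at fine period `Lc·1` has the cell word's value with the same prefactor (`κ = c`, `γ = 1`). -/
theorem deepPairing_one_eq_zero (j : ℕ) (μ α ν β : Fin (d + 1)) :
    ∑ y ∈ box (d + 1) 1, ∑ a : Fin (d + 1),
        ((if a = μ then ((((1 : ℕ) : ℝ))⁻¹ * (((1 : ℕ) : ℝ))⁻¹) * ((((toSite y α % ((1 : ℕ) : ℤ)) : ℤ) : ℝ) - (((1 : ℕ) : ℝ) - 1) / 2) else 0)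
          + (if a = α then (-(((1 : ℕ) : ℝ))⁻¹ * ((((toSite y μ % ((1 : ℕ) : ℤ)) : ℤ) : ℝ) - (((1 : ℕ) : ℝ) - 1) / 2)) *
              (if toSite y α % ((1 : ℕ) : ℤ) = ((1 : ℕ) : ℤ) - 1 then (1 : ℝ) else 0) else 0)) *
        ∑' s : Site (d + 1), ∑ b' : Fin (d + 1), E2 d Lc (j + 2) (toSite y) s (Sum.inl a) (Sum.inl b') *
          ((if b' = ν then ((((1 : ℕ) : ℝ))⁻¹ * (((1 : ℕ) : ℝ))⁻¹) * ((((s β % ((1 : ℕ) : ℤ)) : ℤ) : ℝ) - (((1 : ℕ) : ℝ) - 1) / 2) else 0)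
            + (if b' = β then (-(((1 : ℕ) : ℝ))⁻¹ * ((((s ν % ((1 : ℕ) : ℤ)) : ℤ) : ℝ) - (((1 : ℕ) : ℝ) - 1) / 2)) *
                (if s β % ((1 : ℕ) : ℤ) = ((1 : ℕ) : ℤ) - 1 then (1 : ℝ) else 0) else 0)) = 0 := by
  refine Finset.sum_eq_zero fun y _ => Finset.sum_eq_zero fun a _ => ?_
  rw [qProfileOne_eq_zero (d := d) μ α a (toSite y), zero_mul]

end Summit.QuantumFields.BalabanUV.Beta.GAN24.FaceWordEECellOne

end
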